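import Literature.MathematicalPhysics.QuantumFieldTheory.Balaban1983to89.B5CombesThomasTorus

/-!
# `Balaban1983to89.B5Local114G0First` — the localized L² bounds (1.114) FOR G₀ = (Δ + aQ*Q)⁻¹ ON THE TORUS, first-order
# entries: `‖ζG₀J‖, ‖ζ∇G₀J‖, ‖ζG₀∇*J‖, ‖ζ∇G₀∇*J‖ ≤ O(1)e^{−δ₀|y−y′|}|ζ|‖J‖` for supp ζ ⊂ Δ̃(y), supp J ⊂ Δ̃(y′), proved by the
# p. 36 «simplest proof» route (`B5CombesThomasTorus`)

statement-level skeleton of published theorems with citation tags; proofs where landed; nothing here is a claim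
about the Yang–Mills mass gap

Source (lit-balaban cell, Phase-2 proof seat p38 gen 5): T. Bałaban, *Propagators and renormalization transformations
for lattice gauge theories. I*, Commun. Math. Phys. **95** (1984) 17–40 [`Balaban1984PropagatorsI`, "B5"], pp. 35–36
[PDF 19–20] ((1.110)–(1.114)), p. 36 (the route), p. 39 [PDF 23] (G₀); held as `paper:balaban1984-cmp95-propagators-rt-i`.

## WHAT IS PRINTED (verbatim)

p. 36 [PDF 20], (1.114): «Finally there exists a constant O(1) such that ‖ζGJ‖, ‖ζ∇GJ‖, ‖ζG∇*J‖, ‖ζ∇G∇*J‖, ‖ζ∇∇GJ‖,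
‖ζG∇*∇*J‖ ≤ O(1)e^{−δ₀|y−y′|}|ζ|‖J‖ (1.114) for supp ζ ⊂ Δ̃(y), supp J ⊂ Δ̃(y′).»
p. 39 [PDF 23]: «We will prove (1.115)–(1.117), and in fact the whole Proposition 1.2, for the operator G₀. … We only
have to know some weak bounds for G₀, for example bounds in the L²-norm (1.89), or (1.114).»
p. 36: «Probably the simplest proof of the exponential decay properties can be obtained by … proving that the operator
e^{−⟨q,x⟩}Δ_a e^{⟨q,x⟩} − Δ_a is a small perturbation of Δ_a for vectors q ∈ R^d sufficiently small.»

## WHAT THIS MODULE PROVES (kernel-checked, zero sorry)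

For the scalar operator G₀^{(μ)} = `B5Eq133G0Torus.G0 P a m² k μ` on T_η = `Site P 0` (Bałaban's levels k ≤ m + K,
a > 0, m² ≥ 0), under (1.90) `hco : γ₀·u·(Δ + 1)u ≤ u·M0u` and the smallness `4δ ≤ 1`, `(2d + 16a)δ² ≤ γ₀/2` of the
conjugation exponent, TWO-CUT-OFF BOUNDS with explicit constants — cut-off `U` supported within `distX ≤ r` of the
corner of y ∈ T₁^{(k)} and bounded by b, source `g` supported in Δ̃(y′):
§1 geometry of the weight ρ = distX(·, corner of y′): ρ ≤ 1 on Δ̃(y′) (`rho_le_one_of_inCube`), ρ ≥ |y − y′| − r on the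
   support of U (`T_sub_le_rho`); the extraction lemmas `loc_value`, `loc_deriv`, `nsq_wt_source_le`;
§2 `‖U·G₀g‖ ≤ b(2/γ₀)e^{δ(r+1)}e^{−δ|y−y′|}‖g‖` (`cut_G0_sq_le`), `‖U·∂_λG₀g‖` (`cut_dG0_sq_le`), `‖U·G₀∂*_νg‖`
   (`cut_G0dT_sq_le`), `‖U·∂_λG₀∂*_νg‖` (`cut_dG0dT_sq_le`) — all as bounds of the unweighted Σ_x(·)² (`nsq`);
§3 the entries n = 0, 1, 2, 3 of (1.114) in the vocabulary of `B5G0SettingTorus` (`opL2loc P k (G0 …) n J ζ`, vector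
   sources J, cut-offs ζ with `cutIn`/`suppIn`, the η^d-weighted norms `l2Fam`/`l2NormV`, `supN`):
   `opL2loc_zero_le`, `opL2loc_one_le`, `opL2loc_two_le`, `opL2loc_three_le`, each ≤ C·e^{−δ|y−y′|}·|ζ|·‖J‖ with
   C = d·(12/γ₀)·e^{2δ} (not optimised).
The second-order entry n = 4 (and G₀∇*∇* for 2-tensor sources) is the next file (`B5Local114G0Second`); the assembly
`Prop11Printed → Local114Fam` for the G₀-settings is `B5Local114G0Torus`.

## HONEST SCOPE / DIVERGENCE

Method = the p. 36 alternative (exponential conjugation), NOT the random walk (1.118)–(1.131) the paper carries out;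
statements = the printed (1.114) for G₀ read on the torus exactly as `B5G0SettingTorus` reads them (per direction μ,
vector sources).  Constants depend on (d, a, γ₀) only — «O(1)» and «δ₀ depending on d only» once γ₀ = γ₀(d) (Prop. 1.1,
a = 1).  CELL BOOK-KEEPING (lit-balaban): row B5.Prop1.2, census item (vi) «h114G0» (owner r02, referee ref-4); VALUE =
four of the six L² bounds (1.114) for Bałaban's concrete G₀ on the torus, kernel-checked — NOT summit progress.
-/

namespace Literature.MathematicalPhysics.QuantumFieldTheory.Balaban1983to89

open Matrix Finset

noncomputable section

namespace B5Local114G0First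

open B1RG242Torus B5Ineq137Torus B5GpSettingTorus B5Eq133G0Torus B5G0SettingTorus B5Pieces133Torus
  B5CombesThomasTorus

variable {P : Params} {k : ℕ}

/-! ## §1 The weight ρ = distX(·, corner of y′) and the extraction lemmas -/

variable (P) in
/-- **ρ_{y′}(x) = |x − y′|** in η-units: the scaled sup torus distance from x to the corner representative of y′ — the
exponent of the conjugation e^{δρ} used for sources supported in Δ̃(y′). [cite: Balaban1984PropagatorsI, p.36 («e^{⟨q,x⟩}»), p.35 (Δ̃(y′))] -/
def rhoY (k : ℕ) (y' : Site P k) (x : Site P 0) : ℝ := distX P k x (fine P k y')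

/-- ρ_{y′} is `distX`-Lipschitz. [cite: Balaban1984PropagatorsI, p.36] -/
theorem lipX_rhoY (k : ℕ) (y' : Site P k) : LipX P k (rhoY P k y') := lipX_distX k _

/-- `0 ≤ ρ_{y′}`. [cite: Balaban1984PropagatorsI, p.35 (Δ̃(y′))] -/
theorem rhoY_nonneg (k : ℕ) (y' : Site P k) (x : Site P 0) : 0 ≤ rhoY P k y' x := distX_nonneg P k _ _

/-- **on Δ̃(y′) the weight exponent is ≤ 1**: `x ∈ Δ̃(y′) ⟹ ρ_{y′}(x) ≤ 1`. [cite: Balaban1984PropagatorsI, p.35 («cubes of size 2 and with a center at y»)] -/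
theorem rhoY_le_one_of_inCube {y' : Site P k} {x : Site P 0} (h : inCube P k x y') : rhoY P k y' x ≤ 1 := by
  unfold rhoY distX
  unfold inCube at h
  have hL : (0 : ℝ) < (P.L : ℝ) ^ k := pow_pos P.cast_L_pos k
  rw [inv_mul_le_iff₀ hL, mul_one]
  exact h

/-- **off Δ̃(y) the weight exponent is large**: `distX(x, corner of y) ≤ r ⟹ |y − y′| − r ≤ ρ_{y′}(x)` (k ≤ m + K).
[cite: Balaban1984PropagatorsI, (1.114) p.36 («e^{−δ₀|y−y′|}»)] -/
theorem T_sub_le_rhoY (hk : k ≤ P.m + P.K) (y y' : Site P k) {x : Site P 0} {r : ℝ}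
    (h : distX P k x (fine P k y) ≤ r) : T P k y y' - r ≤ rhoY P k y' x := by
  unfold rhoY distX
  unfold distX at h
  have hL : (0 : ℝ) < (P.L : ℝ) ^ k := pow_pos P.cast_L_pos k
  have e := T_fine_fine P hk y y'
  have t := T_triangle P 0 (fine P k y) x (fine P k y')
  rw [T_symm P 0 (fine P k y) x] at t
  have h1 : (P.L : ℝ) ^ k * T P k y y' ≤ T P 0 x (fine P k y) + T P 0 x (fine P k y') := by rw [← e]; exact t
  have h2 : T P 0 x (fine P k y) ≤ (P.L : ℝ) ^ k * r := by rwa [inv_mul_le_iff₀ hL] at h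
  rw [le_inv_mul_iff₀ hL]
  nlinarith

/-- `inCube` is the case r = 1 of the support hypothesis. [cite: Balaban1984PropagatorsI, p.35 (Δ̃(y))] -/
theorem distX_le_one_of_inCube {y : Site P k} {x : Site P 0} (h : inCube P k x y) : distX P k x (fine P k y) ≤ 1 :=
  rhoY_le_one_of_inCube h

/-- **value extraction**: for a cut-off U supported within `distX ≤ r` of the corner of y and bounded by b, and any u,
`Σ_x (U·e^{−δρ_{y′}}u)² ≤ (b·e^{δr}·e^{−δ|y−y′|})²·Σ_x u²`. [cite: Balaban1984PropagatorsI, (1.114) p.36] -/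
theorem loc_value (hk : k ≤ P.m + P.K) {δ : ℝ} (hδ0 : 0 ≤ δ) (y y' : Site P k) {r b : ℝ} (hb : 0 ≤ b)
    (U u : Site P 0 → ℝ) (hU : ∀ x, U x ≠ 0 → distX P k x (fine P k y) ≤ r) (hUb : ∀ x, |U x| ≤ b) :
    nsq P (fun x => U x * ((wt P δ (rhoY P k y') x)⁻¹ * u x))
      ≤ (b * Real.exp (δ * r) * Real.exp (-(δ * T P k y y'))) ^ 2 * nsq P u := by
  unfold nsq
  rw [mul_sum]
  refine sum_le_sum fun x _ => ?_
  dsimp only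
  by_cases hx : U x = 0
  · rw [hx, zero_mul, zero_pow two_ne_zero]; positivity
  have hr := T_sub_le_rhoY hk y y' (hU x hx)
  have hw : (wt P δ (rhoY P k y') x)⁻¹ ≤ Real.exp (δ * r) * Real.exp (-(δ * T P k y y')) := by
    rw [wt, ← Real.exp_neg, ← Real.exp_add]
    apply Real.exp_le_exp.mpr
    nlinarith
  have hw0 : 0 ≤ (wt P δ (rhoY P k y') x)⁻¹ := (inv_pos.mpr (wt_pos δ _ x)).le
  have h1 : |U x * ((wt P δ (rhoY P k y') x)⁻¹ * u x)| ≤ b * Real.exp (δ * r) * Real.exp (-(δ * T P k y y')) * |u x| := by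
    rw [abs_mul, abs_mul, abs_of_nonneg hw0]
    calc |U x| * ((wt P δ (rhoY P k y') x)⁻¹ * |u x|) ≤ b * ((Real.exp (δ * r) * Real.exp (-(δ * T P k y y'))) * |u x|) :=
          mul_le_mul (hUb x) (mul_le_mul_of_nonneg_right hw (abs_nonneg _)) (by positivity) hb
      _ = _ := by ring
  have h2 := pow_le_pow_left₀ (abs_nonneg _) h1 2
  rw [sq_abs] at h2
  calc (U x * ((wt P δ (rhoY P k y') x)⁻¹ * u x)) ^ 2
      ≤ (b * Real.exp (δ * r) * Real.exp (-(δ * T P k y y')) * |u x|) ^ 2 := h2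
    _ = (b * Real.exp (δ * r) * Real.exp (-(δ * T P k y y'))) ^ 2 * u x ^ 2 := by rw [mul_pow, sq_abs]

/-- **derivative extraction**: with the same U, for any u and direction λ,
`Σ_x (U·∂_λ(e^{−δρ}u))² ≤ (b·e^{δr}·e^{−δ|y−y′|})²·3·(Σ(∂_λu)² + Σu²)` (product rule, 4δ ≤ 1).
[cite: Balaban1984PropagatorsI, (1.114) p.36] -/
theorem loc_deriv (hk : k ≤ P.m + P.K) {δ : ℝ} (hδ0 : 0 ≤ δ) (hδ4 : 4 * δ ≤ 1) (y y' : Site P k) {r b : ℝ}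
    (hb : 0 ≤ b) (U u : Site P 0 → ℝ) (hU : ∀ x, U x ≠ 0 → distX P k x (fine P k y) ≤ r) (hUb : ∀ x, |U x| ≤ b)
    (lam : Fin P.d) :
    nsq P (fun x => U x * (deriv P 0 ((P.L : ℝ) ^ k)⁻¹ lam *ᵥ pmul (fun z => (wt P δ (rhoY P k y') z)⁻¹) u) x)
      ≤ (b * Real.exp (δ * r) * Real.exp (-(δ * T P k y y'))) ^ 2 * 3 *
          (nsq P (deriv P 0 ((P.L : ℝ) ^ k)⁻¹ lam *ᵥ u) + nsq P u) := by
  set ρ := rhoY P k y' with hρdef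
  have hρ' : LipX P k (fun z => -ρ z) := (lipX_rhoY k y').neg
  -- the inverse weight is the weight of −ρ
  have hwinv : (fun z => (wt P δ ρ z)⁻¹) = wt P δ (fun z => -ρ z) := by
    funext z; exact wt_inv δ ρ z
  rw [hwinv]
  unfold nsq
  rw [← sum_add_distrib, mul_sum]
  refine sum_le_sum fun x _ => ?_
  dsimp only
  set A := |(deriv P 0 ((P.L : ℝ) ^ k)⁻¹ lam *ᵥ u) x| with hA
  set B := |u x| with hB
  have hpt := abs_deriv_pmul_le hρ' hδ0 hδ4 lam u x
  -- wt δ (−ρ) x = (wt δ ρ x)⁻¹ ≤ e^{δr} e^{−δT} on supp U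
  by_cases hx : U x = 0
  · rw [hx, zero_mul, zero_pow two_ne_zero]; positivity
  have hr := T_sub_le_rhoY hk y y' (hU x hx)
  have hw : wt P δ (fun z => -ρ z) x ≤ Real.exp (δ * r) * Real.exp (-(δ * T P k y y')) := by
    rw [wt, ← Real.exp_add]
    apply Real.exp_le_exp.mpr
    have : δ * (T P k y y' - r) ≤ δ * ρ x := mul_le_mul_of_nonneg_left hr hδ0
    linarith
  have hw0 : 0 ≤ wt P δ (fun z => -ρ z) x := (wt_pos δ _ x).le
  set E := Real.exp (δ * r) * Real.exp (-(δ * T P k y y')) with hE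
  have hE0 : 0 ≤ E := by positivity
  have h1 : |U x * (deriv P 0 ((P.L : ℝ) ^ k)⁻¹ lam *ᵥ pmul (wt P δ fun z => -ρ z) u) x|
      ≤ b * E * (3 / 2 * A + 2 * δ * B) := by
    rw [abs_mul]
    calc |U x| * |(deriv P 0 ((P.L : ℝ) ^ k)⁻¹ lam *ᵥ pmul (wt P δ fun z => -ρ z) u) x|
        ≤ b * (wt P δ (fun z => -ρ z) x * (3 / 2 * A + 2 * δ * B)) :=
          mul_le_mul (hUb x) hpt (abs_nonneg _) hb
      _ ≤ b * (E * (3 / 2 * A + 2 * δ * B)) := by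
          refine mul_le_mul_of_nonneg_left (mul_le_mul_of_nonneg_right hw ?_) hb
          positivity
      _ = b * E * (3 / 2 * A + 2 * δ * B) := by ring
  have h2 := pow_le_pow_left₀ (abs_nonneg _) h1 2
  rw [sq_abs] at h2
  have h3 : (3 / 2 * A + 2 * δ * B) ^ 2 ≤ 3 * (A ^ 2 + B ^ 2) := by
    have h2δ : 2 * δ ≤ 1 / 2 := by linarith
    have hA0 : 0 ≤ A := abs_nonneg _
    have hB0 : 0 ≤ B := abs_nonneg _
    have hle : 3 / 2 * A + 2 * δ * B ≤ 3 / 2 * A + 1 / 2 * B := by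
      have := mul_le_mul_of_nonneg_right h2δ hB0; linarith
    have hnn : 0 ≤ 3 / 2 * A + 2 * δ * B := by positivity
    have hsq1 := pow_le_pow_left₀ hnn hle 2
    nlinarith [sq_nonneg (A - B)]
  have hA2 : A ^ 2 = ((deriv P 0 ((P.L : ℝ) ^ k)⁻¹ lam *ᵥ u) x) ^ 2 := sq_abs _
  have hB2 : B ^ 2 = u x ^ 2 := sq_abs _
  calc (U x * (deriv P 0 ((P.L : ℝ) ^ k)⁻¹ lam *ᵥ pmul (wt P δ fun z => -ρ z) u) x) ^ 2
      ≤ (b * E * (3 / 2 * A + 2 * δ * B)) ^ 2 := h2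
    _ = (b * E) ^ 2 * (3 / 2 * A + 2 * δ * B) ^ 2 := by ring
    _ ≤ (b * E) ^ 2 * (3 * (A ^ 2 + B ^ 2)) := mul_le_mul_of_nonneg_left h3 (sq_nonneg _)
    _ = (b * Real.exp (δ * r) * Real.exp (-(δ * T P k y y'))) ^ 2 * 3 *
          (((deriv P 0 ((P.L : ℝ) ^ k)⁻¹ lam *ᵥ u) x) ^ 2 + u x ^ 2) := by rw [hA2, hB2, hE]; ring

/-- **source side**: `Σ_x (e^{δρ_{y′}}g)² ≤ e^{2δ}·Σ_x g²` for supp g ⊂ Δ̃(y′) (ρ ≤ 1 there).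
[cite: Balaban1984PropagatorsI, (1.114) p.36 («supp J ⊂ Δ̃(y′)»)] -/
theorem nsq_wt_source_le {δ : ℝ} (hδ0 : 0 ≤ δ) (y' : Site P k) (g : Site P 0 → ℝ)
    (hg : ∀ x, g x ≠ 0 → inCube P k x y') :
    nsq P (pmul (wt P δ (rhoY P k y')) g) ≤ Real.exp δ ^ 2 * nsq P g := by
  unfold nsq
  rw [mul_sum]
  refine sum_le_sum fun x _ => ?_
  rw [pmul_apply]
  by_cases hx : g x = 0
  · rw [hx, mul_zero, zero_pow two_ne_zero, mul_zero]
  have h1 : wt P δ (rhoY P k y') x ≤ Real.exp δ := by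
    rw [wt]
    apply Real.exp_le_exp.mpr
    have := mul_le_mul_of_nonneg_left (rhoY_le_one_of_inCube (hg x hx)) hδ0
    linarith
  have h0 := (wt_pos (P := P) δ (rhoY P k y') x).le
  rw [mul_pow]
  exact mul_le_mul_of_nonneg_right (pow_le_pow_left₀ h0 h1 2) (sq_nonneg _)

/-! ## §2 The four two-cut-off bounds -/

section Entries

variable {a msq γ₀ δ : ℝ} {μ : Fin P.d}

/-- **‖U·G₀g‖**: `Σ_x (U·G₀g)² ≤ (b·(2/γ₀)·e^{δ(r+1)}·e^{−δ|y−y′|})²·Σ_x g²`. [cite: Balaban1984PropagatorsI, (1.114) p.36 (‖ζGJ‖), p.39 (for G₀)] -/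
theorem cut_G0_sq_le (hk : k ≤ P.m + P.K) (ha : 0 < a) (hm : 0 ≤ msq) (hγ : 0 < γ₀)
    (hco : ∀ f : Site P 0 → ℝ, γ₀ * (f ⬝ᵥ ((lapEta P k + 1) *ᵥ f)) ≤ f ⬝ᵥ (M0 P a msq k μ *ᵥ f))
    (hδ0 : 0 ≤ δ) (hδ4 : 4 * δ ≤ 1) (hδγ : (2 * P.d + 16 * a) * δ ^ 2 ≤ γ₀ / 2)
    (y y' : Site P k) {r b : ℝ} (hb : 0 ≤ b) (U g : Site P 0 → ℝ)
    (hU : ∀ x, U x ≠ 0 → distX P k x (fine P k y) ≤ r) (hUb : ∀ x, |U x| ≤ b)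
    (hg : ∀ x, g x ≠ 0 → inCube P k x y') :
    nsq P (fun x => U x * (G0 P a msq k μ *ᵥ g) x)
      ≤ (b * (2 / γ₀) * Real.exp (δ * (r + 1)) * Real.exp (-(δ * T P k y y'))) ^ 2 * nsq P g := by
  set ρ := rhoY P k y' with hρ
  set w := wt P δ ρ with hw
  set v := G0 P a msq k μ *ᵥ g with hv
  set u := pmul w v with hu
  have hvu : ∀ x, v x = (w x)⁻¹ * u x := by
    intro x; rw [hu, pmul_apply, ← mul_assoc, inv_mul_cancel₀ (wt_ne_zero δ ρ x), one_mul]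
  have h1 := loc_value hk hδ0 y y' hb U u hU hUb
  have h1' : nsq P (fun x => U x * v x) ≤ (b * Real.exp (δ * r) * Real.exp (-(δ * T P k y y'))) ^ 2 * nsq P u := by
    have e : (fun x => U x * v x) = fun x => U x * ((wt P δ (rhoY P k y') x)⁻¹ * u x) := by
      funext x; rw [hvu]
    rw [e]; exact h1
  have h2 := solve_bound (lipX_rhoY k y') hk ha hm μ hγ hco hδ0 hδ4 hδγ g
  have h2' : nsq P u ≤ (2 / γ₀) ^ 2 * nsq P (pmul w g) := by
    have := dirE_nonneg (P := P) k u; rw [hu, hw, hρ] at this ⊢; linarith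
  have h3 := nsq_wt_source_le hδ0 y' g hg
  have hE : Real.exp (δ * (r + 1)) = Real.exp (δ * r) * Real.exp δ := by rw [← Real.exp_add]; ring_nf
  calc nsq P (fun x => U x * v x)
      ≤ (b * Real.exp (δ * r) * Real.exp (-(δ * T P k y y'))) ^ 2 * nsq P u := h1'
    _ ≤ (b * Real.exp (δ * r) * Real.exp (-(δ * T P k y y'))) ^ 2 * ((2 / γ₀) ^ 2 * (Real.exp δ ^ 2 * nsq P g)) := by
        refine mul_le_mul_of_nonneg_left (h2'.trans ?_) (sq_nonneg _)
        exact mul_le_mul_of_nonneg_left h3 (sq_nonneg _)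
    _ = (b * (2 / γ₀) * Real.exp (δ * (r + 1)) * Real.exp (-(δ * T P k y y'))) ^ 2 * nsq P g := by rw [hE]; ring

/-- **‖U·∂_λG₀g‖**: `Σ_x (U·∂_λG₀g)² ≤ (b·(4/γ₀)·e^{δ(r+1)}·e^{−δ|y−y′|})²·Σ_x g²`. [cite: Balaban1984PropagatorsI, (1.114) p.36 (‖ζ∇GJ‖), p.39 (for G₀)] -/
theorem cut_dG0_sq_le (hk : k ≤ P.m + P.K) (ha : 0 < a) (hm : 0 ≤ msq) (hγ : 0 < γ₀)
    (hco : ∀ f : Site P 0 → ℝ, γ₀ * (f ⬝ᵥ ((lapEta P k + 1) *ᵥ f)) ≤ f ⬝ᵥ (M0 P a msq k μ *ᵥ f))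
    (hδ0 : 0 ≤ δ) (hδ4 : 4 * δ ≤ 1) (hδγ : (2 * P.d + 16 * a) * δ ^ 2 ≤ γ₀ / 2)
    (y y' : Site P k) {r b : ℝ} (hb : 0 ≤ b) (U g : Site P 0 → ℝ)
    (hU : ∀ x, U x ≠ 0 → distX P k x (fine P k y) ≤ r) (hUb : ∀ x, |U x| ≤ b)
    (hg : ∀ x, g x ≠ 0 → inCube P k x y') (lam : Fin P.d) :
    nsq P (fun x => U x * (deriv P 0 ((P.L : ℝ) ^ k)⁻¹ lam *ᵥ (G0 P a msq k μ *ᵥ g)) x)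
      ≤ (b * (4 / γ₀) * Real.exp (δ * (r + 1)) * Real.exp (-(δ * T P k y y'))) ^ 2 * nsq P g := by
  set ρ := rhoY P k y' with hρ
  set w := wt P δ ρ with hw
  set v := G0 P a msq k μ *ᵥ g with hv
  set u := pmul w v with hu
  have hvu : v = pmul (fun z => (wt P δ (rhoY P k y') z)⁻¹) u := by
    rw [hu, hw, hρ, pmul_inv_pmul _ _ (wt_ne_zero δ _)]
  have h1 := loc_deriv hk hδ0 hδ4 y y' hb U u hU hUb lam
  rw [← hvu] at h1
  have h2 := solve_bound (lipX_rhoY k y') hk ha hm μ hγ hco hδ0 hδ4 hδγ g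
  have h2u : dirE P k u + nsq P u ≤ (2 / γ₀) ^ 2 * nsq P (pmul w g) := by rw [hu, hw, hρ, hv]; exact h2
  have h2' : nsq P (deriv P 0 ((P.L : ℝ) ^ k)⁻¹ lam *ᵥ u) + nsq P u ≤ (2 / γ₀) ^ 2 * nsq P (pmul w g) := by
    have hd : nsq P (deriv P 0 ((P.L : ℝ) ^ k)⁻¹ lam *ᵥ u) ≤ dirE P k u := sum_sq_deriv_le_dirE (P := P) k lam u
    linarith
  have h3 := nsq_wt_source_le hδ0 y' g hg
  have hE : Real.exp (δ * (r + 1)) = Real.exp (δ * r) * Real.exp δ := by rw [← Real.exp_add]; ring_nf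
  have hsq0 : 0 ≤ (b * Real.exp (δ * r) * Real.exp (-(δ * T P k y y'))) ^ 2 * 3 := by positivity
  have hZ : 0 ≤ (b * Real.exp (δ * r) * Real.exp (-(δ * T P k y y')) * (2 / γ₀) * Real.exp δ) ^ 2 * nsq P g :=
    mul_nonneg (sq_nonneg _) (nsq_nonneg g)
  calc nsq P (fun x => U x * (deriv P 0 ((P.L : ℝ) ^ k)⁻¹ lam *ᵥ v) x)
      ≤ (b * Real.exp (δ * r) * Real.exp (-(δ * T P k y y'))) ^ 2 * 3 *
          (nsq P (deriv P 0 ((P.L : ℝ) ^ k)⁻¹ lam *ᵥ u) + nsq P u) := h1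
    _ ≤ (b * Real.exp (δ * r) * Real.exp (-(δ * T P k y y'))) ^ 2 * 3 *
          ((2 / γ₀) ^ 2 * (Real.exp δ ^ 2 * nsq P g)) := by
        refine mul_le_mul_of_nonneg_left (h2'.trans ?_) hsq0
        exact mul_le_mul_of_nonneg_left h3 (sq_nonneg _)
    _ = 3 * ((b * Real.exp (δ * r) * Real.exp (-(δ * T P k y y')) * (2 / γ₀) * Real.exp δ) ^ 2 * nsq P g) := by ring
    _ ≤ 4 * ((b * Real.exp (δ * r) * Real.exp (-(δ * T P k y y')) * (2 / γ₀) * Real.exp δ) ^ 2 * nsq P g) := by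
        linarith
    _ = (b * (4 / γ₀) * Real.exp (δ * (r + 1)) * Real.exp (-(δ * T P k y y'))) ^ 2 * nsq P g := by rw [hE]; ring

/-- **‖U·G₀∂*_νg‖** (∂*_ν = transpose): `Σ_x (U·G₀∂ᵀ_νg)² ≤ (b·(4/γ₀)·e^{δ(r+1)}·e^{−δ|y−y′|})²·Σ_x g²`.
[cite: Balaban1984PropagatorsI, (1.114) p.36 (‖ζG∇*J‖), p.39 (for G₀)] -/
theorem cut_G0dT_sq_le (hk : k ≤ P.m + P.K) (ha : 0 < a) (hm : 0 ≤ msq) (hγ : 0 < γ₀)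
    (hco : ∀ f : Site P 0 → ℝ, γ₀ * (f ⬝ᵥ ((lapEta P k + 1) *ᵥ f)) ≤ f ⬝ᵥ (M0 P a msq k μ *ᵥ f))
    (hδ0 : 0 ≤ δ) (hδ4 : 4 * δ ≤ 1) (hδγ : (2 * P.d + 16 * a) * δ ^ 2 ≤ γ₀ / 2)
    (y y' : Site P k) {r b : ℝ} (hb : 0 ≤ b) (U g : Site P 0 → ℝ)
    (hU : ∀ x, U x ≠ 0 → distX P k x (fine P k y) ≤ r) (hUb : ∀ x, |U x| ≤ b)
    (hg : ∀ x, g x ≠ 0 → inCube P k x y') (ν : Fin P.d) :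
    nsq P (fun x => U x * (G0 P a msq k μ *ᵥ ((deriv P 0 ((P.L : ℝ) ^ k)⁻¹ ν)ᵀ *ᵥ g)) x)
      ≤ (b * (4 / γ₀) * Real.exp (δ * (r + 1)) * Real.exp (-(δ * T P k y y'))) ^ 2 * nsq P g := by
  set ρ := rhoY P k y' with hρ
  set w := wt P δ ρ with hw
  set v := G0 P a msq k μ *ᵥ ((deriv P 0 ((P.L : ℝ) ^ k)⁻¹ ν)ᵀ *ᵥ g) with hv
  set u := pmul w v with hu
  have hvu : ∀ x, v x = (w x)⁻¹ * u x := by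
    intro x; rw [hu, pmul_apply, ← mul_assoc, inv_mul_cancel₀ (wt_ne_zero δ ρ x), one_mul]
  have h1 := loc_value hk hδ0 y y' hb U u hU hUb
  have h1' : nsq P (fun x => U x * v x) ≤ (b * Real.exp (δ * r) * Real.exp (-(δ * T P k y y'))) ^ 2 * nsq P u := by
    have e : (fun x => U x * v x) = fun x => U x * ((wt P δ (rhoY P k y') x)⁻¹ * u x) := by
      funext x; rw [hvu]
    rw [e]; exact h1
  have h2 := solveT_bound (lipX_rhoY k y') hk ha hm μ hγ hco hδ0 hδ4 hδγ ν g
  have h2' : nsq P u ≤ (4 / γ₀) ^ 2 * nsq P (pmul w g) := by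
    have h2u : dirE P k u + nsq P u ≤ (4 / γ₀) ^ 2 * nsq P (pmul w g) := by rw [hu, hw, hρ, hv]; exact h2
    linarith [dirE_nonneg (P := P) k u]
  have h3 := nsq_wt_source_le hδ0 y' g hg
  have hE : Real.exp (δ * (r + 1)) = Real.exp (δ * r) * Real.exp δ := by rw [← Real.exp_add]; ring_nf
  calc nsq P (fun x => U x * v x)
      ≤ (b * Real.exp (δ * r) * Real.exp (-(δ * T P k y y'))) ^ 2 * nsq P u := h1'
    _ ≤ (b * Real.exp (δ * r) * Real.exp (-(δ * T P k y y'))) ^ 2 * ((4 / γ₀) ^ 2 * (Real.exp δ ^ 2 * nsq P g)) := by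
        refine mul_le_mul_of_nonneg_left (h2'.trans ?_) (sq_nonneg _)
        exact mul_le_mul_of_nonneg_left h3 (sq_nonneg _)
    _ = (b * (4 / γ₀) * Real.exp (δ * (r + 1)) * Real.exp (-(δ * T P k y y'))) ^ 2 * nsq P g := by rw [hE]; ring

/-- **‖U·∂_λG₀∂*_νg‖**: `Σ_x (U·∂_λG₀∂ᵀ_νg)² ≤ (b·(8/γ₀)·e^{δ(r+1)}·e^{−δ|y−y′|})²·Σ_x g²`.
[cite: Balaban1984PropagatorsI, (1.114) p.36 (‖ζ∇G∇*J‖), p.39 (for G₀)] -/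
theorem cut_dG0dT_sq_le (hk : k ≤ P.m + P.K) (ha : 0 < a) (hm : 0 ≤ msq) (hγ : 0 < γ₀)
    (hco : ∀ f : Site P 0 → ℝ, γ₀ * (f ⬝ᵥ ((lapEta P k + 1) *ᵥ f)) ≤ f ⬝ᵥ (M0 P a msq k μ *ᵥ f))
    (hδ0 : 0 ≤ δ) (hδ4 : 4 * δ ≤ 1) (hδγ : (2 * P.d + 16 * a) * δ ^ 2 ≤ γ₀ / 2)
    (y y' : Site P k) {r b : ℝ} (hb : 0 ≤ b) (U g : Site P 0 → ℝ)
    (hU : ∀ x, U x ≠ 0 → distX P k x (fine P k y) ≤ r) (hUb : ∀ x, |U x| ≤ b)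
    (hg : ∀ x, g x ≠ 0 → inCube P k x y') (lam ν : Fin P.d) :
    nsq P (fun x => U x *
        (deriv P 0 ((P.L : ℝ) ^ k)⁻¹ lam *ᵥ (G0 P a msq k μ *ᵥ ((deriv P 0 ((P.L : ℝ) ^ k)⁻¹ ν)ᵀ *ᵥ g))) x)
      ≤ (b * (8 / γ₀) * Real.exp (δ * (r + 1)) * Real.exp (-(δ * T P k y y'))) ^ 2 * nsq P g := by
  set ρ := rhoY P k y' with hρ
  set w := wt P δ ρ with hw
  set v := G0 P a msq k μ *ᵥ ((deriv P 0 ((P.L : ℝ) ^ k)⁻¹ ν)ᵀ *ᵥ g) with hv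
  set u := pmul w v with hu
  have hvu : v = pmul (fun z => (wt P δ (rhoY P k y') z)⁻¹) u := by
    rw [hu, hw, hρ, pmul_inv_pmul _ _ (wt_ne_zero δ _)]
  have h1 := loc_deriv hk hδ0 hδ4 y y' hb U u hU hUb lam
  rw [← hvu] at h1
  have h2 := solveT_bound (lipX_rhoY k y') hk ha hm μ hγ hco hδ0 hδ4 hδγ ν g
  have h2u : dirE P k u + nsq P u ≤ (4 / γ₀) ^ 2 * nsq P (pmul w g) := by rw [hu, hw, hρ, hv]; exact h2
  have h2' : nsq P (deriv P 0 ((P.L : ℝ) ^ k)⁻¹ lam *ᵥ u) + nsq P u ≤ (4 / γ₀) ^ 2 * nsq P (pmul w g) := by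
    have hd : nsq P (deriv P 0 ((P.L : ℝ) ^ k)⁻¹ lam *ᵥ u) ≤ dirE P k u := sum_sq_deriv_le_dirE (P := P) k lam u
    linarith
  have h3 := nsq_wt_source_le hδ0 y' g hg
  have hE : Real.exp (δ * (r + 1)) = Real.exp (δ * r) * Real.exp δ := by rw [← Real.exp_add]; ring_nf
  have hsq0 : 0 ≤ (b * Real.exp (δ * r) * Real.exp (-(δ * T P k y y'))) ^ 2 * 3 := by positivity
  have hZ : 0 ≤ (b * Real.exp (δ * r) * Real.exp (-(δ * T P k y y')) * (4 / γ₀) * Real.exp δ) ^ 2 * nsq P g :=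
    mul_nonneg (sq_nonneg _) (nsq_nonneg g)
  calc nsq P (fun x => U x * (deriv P 0 ((P.L : ℝ) ^ k)⁻¹ lam *ᵥ v) x)
      ≤ (b * Real.exp (δ * r) * Real.exp (-(δ * T P k y y'))) ^ 2 * 3 *
          (nsq P (deriv P 0 ((P.L : ℝ) ^ k)⁻¹ lam *ᵥ u) + nsq P u) := h1
    _ ≤ (b * Real.exp (δ * r) * Real.exp (-(δ * T P k y y'))) ^ 2 * 3 *
          ((4 / γ₀) ^ 2 * (Real.exp δ ^ 2 * nsq P g)) := by
        refine mul_le_mul_of_nonneg_left (h2'.trans ?_) hsq0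
        exact mul_le_mul_of_nonneg_left h3 (sq_nonneg _)
    _ = 3 * ((b * Real.exp (δ * r) * Real.exp (-(δ * T P k y y')) * (4 / γ₀) * Real.exp δ) ^ 2 * nsq P g) := by ring
    _ ≤ 4 * ((b * Real.exp (δ * r) * Real.exp (-(δ * T P k y y')) * (4 / γ₀) * Real.exp δ) ^ 2 * nsq P g) := by
        linarith
    _ = (b * (8 / γ₀) * Real.exp (δ * (r + 1)) * Real.exp (-(δ * T P k y y'))) ^ 2 * nsq P g := by rw [hE]; ring

end Entries

/-! ## §3 The entries n = 0, 1, 2, 3 of (1.114) for the G₀-settings of `B5G0SettingTorus` -/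

section Packaging

variable {a msq γ₀ δ : ℝ} {μ : Fin P.d}

/-- `∂^η_μ` of `B5G0SettingTorus` with the deriv scale written as η = L^{−k}. [cite: Balaban1984PropagatorsI, (1.108) p.35] -/
theorem dEta_eq (k : ℕ) (ν : Fin P.d) : dEta P k ν = deriv P 0 ((P.L : ℝ) ^ k)⁻¹ ν := by
  rw [dEta, eps_div_spacing]

/-- `Σ_i Σ_x η^d F_i(x)² = η^d Σ_i Σ_x F_i(x)²`. [cite: Balaban1984PropagatorsI, (1.89) p.33 (the L²(T_η) norm)] -/
theorem l2Fam_sq_eq (k : ℕ) {ι : Type} [Fintype ι] (F : ι → Site P 0 → ℝ) :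
    ∑ i, ∑ x, (((P.L : ℝ) ^ k)⁻¹) ^ P.d * (F i x) ^ 2 = (((P.L : ℝ) ^ k)⁻¹) ^ P.d * ∑ i, nsq P (F i) := by
  rw [mul_sum]
  refine sum_congr rfl fun i _ => ?_
  rw [nsq, mul_sum]

/-- ‖J‖² = η^d Σ_ν Σ_x J_ν(x)². [cite: Balaban1984PropagatorsI, (1.89) p.33] -/
theorem l2NormV_eq (k : ℕ) (J : Fin P.d → Site P 0 → ℝ) :
    l2NormV P k J = Real.sqrt ((((P.L : ℝ) ^ k)⁻¹) ^ P.d * ∑ ν, nsq P (J ν)) := by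
  rw [l2NormV, l2Fam_sq_eq]

/-- **packaging**: termwise bounds `Σ_x F_i² ≤ c²·T_i` give `‖F‖ ≤ c·√(η^d Σ_i T_i)`. [cite: Balaban1984PropagatorsI, (1.114) p.36] -/
theorem l2Fam_le_of_nsq_le (k : ℕ) {ι : Type} [Fintype ι] (F : ι → Site P 0 → ℝ) (T : ι → ℝ) {c : ℝ}
    (hc : 0 ≤ c) (h : ∀ i, nsq P (F i) ≤ c ^ 2 * T i) :
    l2Fam P k F ≤ c * Real.sqrt ((((P.L : ℝ) ^ k)⁻¹) ^ P.d * ∑ i, T i) := by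
  rw [l2Fam, l2Fam_sq_eq]
  have hη : 0 ≤ (((P.L : ℝ) ^ k)⁻¹) ^ P.d := pow_nonneg (eta_pos k).le _
  have h1 : (((P.L : ℝ) ^ k)⁻¹) ^ P.d * ∑ i, nsq P (F i) ≤ c ^ 2 * ((((P.L : ℝ) ^ k)⁻¹) ^ P.d * ∑ i, T i) := by
    rw [mul_left_comm, mul_sum (a := c ^ 2)]
    exact mul_le_mul_of_nonneg_left (sum_le_sum fun i _ => h i) hη
  calc Real.sqrt ((((P.L : ℝ) ^ k)⁻¹) ^ P.d * ∑ i, nsq P (F i))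
      ≤ Real.sqrt (c ^ 2 * ((((P.L : ℝ) ^ k)⁻¹) ^ P.d * ∑ i, T i)) := Real.sqrt_le_sqrt h1
    _ = c * Real.sqrt ((((P.L : ℝ) ^ k)⁻¹) ^ P.d * ∑ i, T i) := by
        rw [Real.sqrt_mul (sq_nonneg c), Real.sqrt_sq hc]

/-- `Σ_x (Σ_ν f_ν(x))² ≤ d·Σ_ν Σ_x f_ν(x)²` (Cauchy–Schwarz over the d directions). [cite: Balaban1984PropagatorsI, p.21 («∂*A = Σ_μ ∂*_μA_μ»)] -/
theorem nsq_sum_le (f : Fin P.d → Site P 0 → ℝ) :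
    nsq P (fun x => ∑ ν, f ν x) ≤ P.d * ∑ ν, nsq P (f ν) := by
  unfold nsq
  calc ∑ x, (∑ ν, f ν x) ^ 2 ≤ ∑ x, (P.d : ℝ) * ∑ ν, (f ν x) ^ 2 := by
        refine sum_le_sum fun x _ => ?_
        have := sq_sum_le_card_mul_sum_sq (s := (univ : Finset (Fin P.d))) (f := fun ν => f ν x)
        simpa [card_univ, Fintype.card_fin] using this
    _ = P.d * ∑ ν, ∑ x, (f ν x) ^ 2 := by rw [← mul_sum, sum_comm]

/-- the cut-off hypotheses of the carrier (`cutIn`) give the support/size hypotheses of §2 with r = 1, b = |ζ|.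
[cite: Balaban1984PropagatorsI, (1.114) p.36 («supp ζ ⊂ Δ̃(y)»)] -/
theorem cut_hyps {ζ : Site P 0 → ℝ} {y : Site P k} (hζ : ∀ x, ζ x ≠ 0 → inCube P k x y) :
    (∀ x, ζ x ≠ 0 → distX P k x (fine P k y) ≤ 1) ∧ (∀ x, |ζ x| ≤ supN P ζ) ∧ 0 ≤ supN P ζ :=
  ⟨fun x hx => distX_le_one_of_inCube (hζ x hx), fun x => le_supN P ζ x, supN_nonneg P ζ⟩

/-- `e^{δ(1+1)} = e^{2δ}` bookkeeping. [cite: Balaban1984PropagatorsI, (1.114) p.36] -/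
private theorem exp_one_add_one (δ : ℝ) : Real.exp (δ * (1 + 1)) = Real.exp (2 * δ) := by ring_nf

/-- **(1.114), n = 0, for G₀ on the torus**: `‖ζG₀J‖ ≤ (2/γ₀)e^{2δ}·e^{−δ|y−y′|}·|ζ|·‖J‖`.
[cite: Balaban1984PropagatorsI, (1.114) p.36, p.39 (for G₀)] -/
theorem opL2loc_zero_le (hk : k ≤ P.m + P.K) (ha : 0 < a) (hm : 0 ≤ msq) (hγ : 0 < γ₀)
    (hco : ∀ f : Site P 0 → ℝ, γ₀ * (f ⬝ᵥ ((lapEta P k + 1) *ᵥ f)) ≤ f ⬝ᵥ (M0 P a msq k μ *ᵥ f))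
    (hδ0 : 0 ≤ δ) (hδ4 : 4 * δ ≤ 1) (hδγ : (2 * P.d + 16 * a) * δ ^ 2 ≤ γ₀ / 2)
    (J : Fin P.d → Site P 0 → ℝ) (ζ : Site P 0 → ℝ) (y y' : Site P k)
    (hζ : ∀ x, ζ x ≠ 0 → inCube P k x y) (hJ : ∀ ν x, J ν x ≠ 0 → inCube P k x y') :
    opL2loc P k (G0 P a msq k μ) 0 J ζ
      ≤ (2 / γ₀) * Real.exp (2 * δ) * Real.exp (-(δ * T P k y y')) * supN P ζ * l2NormV P k J := by
  obtain ⟨hU, hUb, hb⟩ := cut_hyps hζ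
  set c := supN P ζ * (2 / γ₀) * Real.exp (δ * (1 + 1)) * Real.exp (-(δ * T P k y y')) with hc
  have hc0 : 0 ≤ c := by positivity
  have h := fun ν => cut_G0_sq_le hk ha hm hγ hco hδ0 hδ4 hδγ y y' hb ζ (J ν) hU hUb (hJ ν)
  have := l2Fam_le_of_nsq_le k (fun ν x => ζ x * (G0 P a msq k μ *ᵥ J ν) x) (fun ν => nsq P (J ν)) hc0 h
  rw [← l2NormV_eq] at this
  show l2Fam P k (fun ν x => ζ x * (G0 P a msq k μ *ᵥ J ν) x) ≤ _
  calc _ ≤ c * l2NormV P k J := this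
    _ = _ := by rw [hc, exp_one_add_one]; ring

/-- **(1.114), n = 1, for G₀ on the torus**: `‖ζ∇G₀J‖ ≤ √d·(4/γ₀)e^{2δ}·e^{−δ|y−y′|}·|ζ|·‖J‖`.
[cite: Balaban1984PropagatorsI, (1.114) p.36, p.39 (for G₀)] -/
theorem opL2loc_one_le (hk : k ≤ P.m + P.K) (ha : 0 < a) (hm : 0 ≤ msq) (hγ : 0 < γ₀)
    (hco : ∀ f : Site P 0 → ℝ, γ₀ * (f ⬝ᵥ ((lapEta P k + 1) *ᵥ f)) ≤ f ⬝ᵥ (M0 P a msq k μ *ᵥ f))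
    (hδ0 : 0 ≤ δ) (hδ4 : 4 * δ ≤ 1) (hδγ : (2 * P.d + 16 * a) * δ ^ 2 ≤ γ₀ / 2)
    (J : Fin P.d → Site P 0 → ℝ) (ζ : Site P 0 → ℝ) (y y' : Site P k)
    (hζ : ∀ x, ζ x ≠ 0 → inCube P k x y) (hJ : ∀ ν x, J ν x ≠ 0 → inCube P k x y') :
    opL2loc P k (G0 P a msq k μ) 1 J ζ
      ≤ Real.sqrt P.d * (4 / γ₀) * Real.exp (2 * δ) * Real.exp (-(δ * T P k y y')) * supN P ζ * l2NormV P k J := by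
  obtain ⟨hU, hUb, hb⟩ := cut_hyps hζ
  set c := supN P ζ * (4 / γ₀) * Real.exp (δ * (1 + 1)) * Real.exp (-(δ * T P k y y')) with hc
  have hc0 : 0 ≤ c := by positivity
  have h : ∀ p : Fin P.d × Fin P.d,
      nsq P (fun x => ζ x * ((dEta P k p.1 * G0 P a msq k μ) *ᵥ J p.2) x) ≤ c ^ 2 * nsq P (J p.2) := by
    intro p
    have := cut_dG0_sq_le hk ha hm hγ hco hδ0 hδ4 hδγ y y' hb ζ (J p.2) hU hUb (hJ p.2) p.1
    simpa only [← Matrix.mulVec_mulVec, dEta_eq] using this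
  have := l2Fam_le_of_nsq_le k (fun (p : Fin P.d × Fin P.d) x => ζ x * ((dEta P k p.1 * G0 P a msq k μ) *ᵥ J p.2) x)
    (fun p => nsq P (J p.2)) hc0 h
  have hsum : ∑ p : Fin P.d × Fin P.d, nsq P (J p.2) = P.d * ∑ ν, nsq P (J ν) := by
    rw [Fintype.sum_prod_type]; dsimp only; rw [sum_const, card_univ, Fintype.card_fin, nsmul_eq_mul]
  have hroot : Real.sqrt ((((P.L : ℝ) ^ k)⁻¹) ^ P.d * ∑ p : Fin P.d × Fin P.d, nsq P (J p.2))
      = Real.sqrt P.d * l2NormV P k J := by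
    rw [hsum, l2NormV_eq, ← Real.sqrt_mul (Nat.cast_nonneg _)]; congr 1; ring
  rw [hroot] at this
  show l2Fam P k (fun (p : Fin P.d × Fin P.d) x => ζ x * ((dEta P k p.1 * G0 P a msq k μ) *ᵥ J p.2) x) ≤ _
  calc _ ≤ c * (Real.sqrt P.d * l2NormV P k J) := this
    _ = _ := by rw [hc, exp_one_add_one]; ring

/-- **(1.114), n = 2, for G₀ on the torus**: `‖ζG₀∇*J‖ ≤ √d·(4/γ₀)e^{2δ}·e^{−δ|y−y′|}·|ζ|·‖J‖` (G₀∇*J = Σ_ν G₀∂*_νJ_ν).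
[cite: Balaban1984PropagatorsI, (1.114) p.36, p.39 (for G₀)] -/
theorem opL2loc_two_le (hk : k ≤ P.m + P.K) (ha : 0 < a) (hm : 0 ≤ msq) (hγ : 0 < γ₀)
    (hco : ∀ f : Site P 0 → ℝ, γ₀ * (f ⬝ᵥ ((lapEta P k + 1) *ᵥ f)) ≤ f ⬝ᵥ (M0 P a msq k μ *ᵥ f))
    (hδ0 : 0 ≤ δ) (hδ4 : 4 * δ ≤ 1) (hδγ : (2 * P.d + 16 * a) * δ ^ 2 ≤ γ₀ / 2)
    (J : Fin P.d → Site P 0 → ℝ) (ζ : Site P 0 → ℝ) (y y' : Site P k)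
    (hζ : ∀ x, ζ x ≠ 0 → inCube P k x y) (hJ : ∀ ν x, J ν x ≠ 0 → inCube P k x y') :
    opL2loc P k (G0 P a msq k μ) 2 J ζ
      ≤ Real.sqrt P.d * (4 / γ₀) * Real.exp (2 * δ) * Real.exp (-(δ * T P k y y')) * supN P ζ * l2NormV P k J := by
  obtain ⟨hU, hUb, hb⟩ := cut_hyps hζ
  set c := supN P ζ * (4 / γ₀) * Real.exp (δ * (1 + 1)) * Real.exp (-(δ * T P k y y')) with hc
  have hc0 : 0 ≤ c := by positivity
  have hν : ∀ ν, nsq P (fun x => ζ x * opK1 P k (G0 P a msq k μ) ν (J ν) x) ≤ c ^ 2 * nsq P (J ν) := by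
    intro ν
    have := cut_G0dT_sq_le hk ha hm hγ hco hδ0 hδ4 hδγ y y' hb ζ (J ν) hU hUb (hJ ν) ν
    simpa only [opK1, ← Matrix.mulVec_mulVec, dEta_eq] using this
  -- ζ·Σ_ν = Σ_ν ζ·
  have hsum : nsq P (fun x => ζ x * opDiv P k (G0 P a msq k μ) J x) ≤ c ^ 2 * (P.d * ∑ ν, nsq P (J ν)) := by
    have e : (fun x => ζ x * opDiv P k (G0 P a msq k μ) J x)
        = fun x => ∑ ν, ζ x * opK1 P k (G0 P a msq k μ) ν (J ν) x := by
      funext x; rw [opDiv, mul_sum]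
    rw [e]
    calc nsq P (fun x => ∑ ν, ζ x * opK1 P k (G0 P a msq k μ) ν (J ν) x)
        ≤ P.d * ∑ ν, nsq P (fun x => ζ x * opK1 P k (G0 P a msq k μ) ν (J ν) x) :=
          nsq_sum_le (fun ν x => ζ x * opK1 P k (G0 P a msq k μ) ν (J ν) x)
      _ ≤ P.d * ∑ ν, c ^ 2 * nsq P (J ν) := mul_le_mul_of_nonneg_left (sum_le_sum fun ν _ => hν ν) (Nat.cast_nonneg _)
      _ = c ^ 2 * (P.d * ∑ ν, nsq P (J ν)) := by rw [← mul_sum]; ring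
  have := l2Fam_le_of_nsq_le k (fun (_ : Unit) x => ζ x * opDiv P k (G0 P a msq k μ) J x)
    (fun _ => (P.d : ℝ) * ∑ ν, nsq P (J ν)) hc0 (fun _ => hsum)
  have hroot : Real.sqrt ((((P.L : ℝ) ^ k)⁻¹) ^ P.d * ∑ _u : Unit, ((P.d : ℝ) * ∑ ν, nsq P (J ν)))
      = Real.sqrt P.d * l2NormV P k J := by
    rw [Fintype.sum_unique, l2NormV_eq, ← Real.sqrt_mul (Nat.cast_nonneg _)]; congr 1; ring
  rw [hroot] at this
  show l2Fam P k (fun (_ : Unit) x => ζ x * opDiv P k (G0 P a msq k μ) J x) ≤ _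
  calc _ ≤ c * (Real.sqrt P.d * l2NormV P k J) := this
    _ = _ := by rw [hc, exp_one_add_one]; ring

/-- **(1.114), n = 3, for G₀ on the torus**: `‖ζ∇G₀∇*J‖ ≤ d·(8/γ₀)e^{2δ}·e^{−δ|y−y′|}·|ζ|·‖J‖`.
[cite: Balaban1984PropagatorsI, (1.114) p.36, p.39 (for G₀)] -/
theorem opL2loc_three_le (hk : k ≤ P.m + P.K) (ha : 0 < a) (hm : 0 ≤ msq) (hγ : 0 < γ₀)
    (hco : ∀ f : Site P 0 → ℝ, γ₀ * (f ⬝ᵥ ((lapEta P k + 1) *ᵥ f)) ≤ f ⬝ᵥ (M0 P a msq k μ *ᵥ f))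
    (hδ0 : 0 ≤ δ) (hδ4 : 4 * δ ≤ 1) (hδγ : (2 * P.d + 16 * a) * δ ^ 2 ≤ γ₀ / 2)
    (J : Fin P.d → Site P 0 → ℝ) (ζ : Site P 0 → ℝ) (y y' : Site P k)
    (hζ : ∀ x, ζ x ≠ 0 → inCube P k x y) (hJ : ∀ ν x, J ν x ≠ 0 → inCube P k x y') :
    opL2loc P k (G0 P a msq k μ) 3 J ζ
      ≤ P.d * (8 / γ₀) * Real.exp (2 * δ) * Real.exp (-(δ * T P k y y')) * supN P ζ * l2NormV P k J := by
  obtain ⟨hU, hUb, hb⟩ := cut_hyps hζ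
  set c := supN P ζ * (8 / γ₀) * Real.exp (δ * (1 + 1)) * Real.exp (-(δ * T P k y y')) with hc
  have hc0 : 0 ≤ c := by positivity
  have hμν : ∀ μ' ν, nsq P (fun x => ζ x * opKDD P k (G0 P a msq k μ) μ' ν (J ν) x) ≤ c ^ 2 * nsq P (J ν) := by
    intro μ' ν
    have := cut_dG0dT_sq_le hk ha hm hγ hco hδ0 hδ4 hδγ y y' hb ζ (J ν) hU hUb (hJ ν) μ' ν
    simpa only [opKDD, ← Matrix.mulVec_mulVec, dEta_eq] using this
  have hsum : ∀ μ', nsq P (fun x => ζ x * opDD P k (G0 P a msq k μ) J μ' x) ≤ c ^ 2 * (P.d * ∑ ν, nsq P (J ν)) := by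
    intro μ'
    have e : (fun x => ζ x * opDD P k (G0 P a msq k μ) J μ' x)
        = fun x => ∑ ν, ζ x * opKDD P k (G0 P a msq k μ) μ' ν (J ν) x := by
      funext x; rw [opDD, mul_sum]
    rw [e]
    calc nsq P (fun x => ∑ ν, ζ x * opKDD P k (G0 P a msq k μ) μ' ν (J ν) x)
        ≤ P.d * ∑ ν, nsq P (fun x => ζ x * opKDD P k (G0 P a msq k μ) μ' ν (J ν) x) :=
          nsq_sum_le (fun ν x => ζ x * opKDD P k (G0 P a msq k μ) μ' ν (J ν) x)
      _ ≤ P.d * ∑ ν, c ^ 2 * nsq P (J ν) :=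
          mul_le_mul_of_nonneg_left (sum_le_sum fun ν _ => hμν μ' ν) (Nat.cast_nonneg _)
      _ = c ^ 2 * (P.d * ∑ ν, nsq P (J ν)) := by rw [← mul_sum]; ring
  have := l2Fam_le_of_nsq_le k (fun μ' x => ζ x * opDD P k (G0 P a msq k μ) J μ' x)
    (fun _ => (P.d : ℝ) * ∑ ν, nsq P (J ν)) hc0 hsum
  have hroot : Real.sqrt ((((P.L : ℝ) ^ k)⁻¹) ^ P.d * ∑ _μ' : Fin P.d, ((P.d : ℝ) * ∑ ν, nsq P (J ν)))
      = P.d * l2NormV P k J := by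
    rw [sum_const, card_univ, Fintype.card_fin, nsmul_eq_mul, l2NormV_eq]
    have e : (((P.L : ℝ) ^ k)⁻¹) ^ P.d * ((P.d : ℝ) * ((P.d : ℝ) * ∑ ν, nsq P (J ν)))
        = ((P.d : ℝ) * P.d) * ((((P.L : ℝ) ^ k)⁻¹) ^ P.d * ∑ ν, nsq P (J ν)) := by ring
    rw [e, Real.sqrt_mul (mul_self_nonneg _), Real.sqrt_mul_self (Nat.cast_nonneg _)]
  rw [hroot] at this
  show l2Fam P k (fun μ' x => ζ x * opDD P k (G0 P a msq k μ) J μ' x) ≤ _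
  calc _ ≤ c * (P.d * l2NormV P k J) := this
    _ = _ := by rw [hc, exp_one_add_one]; ring

end Packaging

end B5Local114G0First

end

end Literature.MathematicalPhysics.QuantumFieldTheory.Balaban1983to89
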